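import Summits.Ventures.Crystal3D.Theorems.StickyWulffConstantGenericWallFloorRayTerraceA
import HarnessLib

/-!
# The untilted terrace ray on the period disc: one push is a fixed rotation (crux `GenericWallFloor`,
# stmt-Ventures-19480, line `WallLedgerG`; kernel side of the K-3 tail table, cf-p1 (lxviii)/(lxx))

HONEST FRAMING. Venture `Summits/Ventures/Crystal3D` (cell `crystal3d-full`), helper `--supports` the crux
`GenericWallFloor` (stmt-Ventures-19480) of `route-Ventures-StickyWulffConstant`, REGISTERED line `WallLedgerG`, open
stub `stub_twoSlabAdhesion`.  Rung credit only; F-C1 not moved; NOT the stub; census-free, standard axioms.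

THE SETTING (the deep-arrival tail of the certificate `ResidualOneSidedCoverage`, 19480-p1 g12 (F1)–(F2), cf-p1 (lxx)).
Base frame `A`, start slot `u = slotSite 8` (cubic `(0,1,1)/√2`), first push normal `n` = the terrace (cubic `(1,1,1)/√3`),
steering `z` with `cubicCoords (A.symm z) = t • Zc`, `t > 0`, and `Zc` in the OPEN PERIOD CONE about the cubic axis
`e = (0,1,2)`: `0 < Zc·e` and `9 (Zc·Zc) < 2 (Zc·e)²` (angular radius `arcsin (1/√10) ≈ 18.4°`; for the untilted walker
`Zc ∥ ν = cubicCoords (A.symm e₃)` this is 19480-p1's disc `D₁ = {⟪ν,(0,1,2)/√5⟫ > 3/√10}`).  In the numerators of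
`…RayPushCubic` (`X = √2·κ(direction)`, `P = √3·κ(push normal)`, `κ = cubicCoords ∘ A.symm`):

* `rotE c s` — the rotation about `e` with cosine `c` and sine `√5·s` (Rodrigues' formula; rational in `(c,s)` on the
  ellipse `c² + 5s² = 1`): linear, fixes `·e` exactly (`rotE_dotProduct_e`), and on the ellipse preserves dot products
  (`rotE_dotProduct`) and cross products (`rotE_cross`); `rotE_rotE` is the angle-addition law (exact).
* `cone_pos` — CONE POSITIVITY: for `Zc` in the open period cone and `v` with `0 < v·e`, `v·v ≤ 2 (v·e)²`: `0 < Zc·v`.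
* **`terraceDisc_push`** — ONE PUSH IS THE ROTATION `ρ = rotE (−2/3) (−1/3)` (angle `arccos (−2/3)` about `(0,1,2)`): if a
  level has numerators `(rotE c s (0,1,1), rotE c s (1,1,1))` then for EVERY `Zc` in the cone the THIRD member
  `rotE c s (1,1,0)` of the rising triple is strictly `Zc`-lowest (margins: `v·e = 2, v·v = 2` against the first member and
  the TIGHT `v·e = 1, v·v = 2` against the second — the tie plane is tangent to the cone), and the next level has numerators
  `(rotE c' s' (0,1,1), rotE c' s' (1,1,1))` with `(c', s') = (−2c/3 + 5s/3, −c/3 − 2s/3)` = the parameters of `rotE c s ∘ ρ`.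
* `discCS k` — the parameters of `ρᵏ` (`discCS_ellipse`); **`terraceDisc_levels`** — level `k` of the forced ray
  `forcedTop z ⟨A, slotSite 8, 0⟩ n k` has direction numerator `rotE (discCS (k+1)) (0,1,1)` and next push normal numerator
  `rotE (discCS (k+1)) (1,1,1)`, for every `Zc` in the cone (the bottom `(u, n)` is `ρ⁰`); `terraceDisc_dir_dotProduct_e` —
  hence every direction numerator has `X·e = 3` (rise cosine `3/√10` against the axis).
So on the disc the ray is ν-INDEPENDENT in grain coordinates and `ρ⁴` is 19480-p1's `P = R_aR_bR_cR_d` (`cos θ = −79/81`,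
infinite order).  The frames (`ρᵏ · W_{k mod 4}`) and the 4-periodic WORD are the next file.
WHAT THIS IS NOT: no statement about packings or cells; not the stub; F-C1 not moved; the lens `Cap ∖ (D₁ ∪ D₂)` is not
touched (there the word is aperiodic, 19480-p1 (F2)).
-/

noncomputable section

namespace Summit.Ventures.Crystal3D.Theorems

open Summit.Ventures.Crystal3D Finset Matrix
open scoped InnerProductSpace

/-! ### The rotation about the cubic axis `(0,1,2)` -/

/-- **Rotation about `e = (0,1,2)`** with cosine `c` and sine `√5·s` (a rotation iff `c² + 5s² = 1`), by Rodrigues'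
formula `c·v + s·(e × v) + ((1 − c)/5)(e·v)·e`, written out in coordinates. -/
def rotE (c s : ℝ) (v : Fin 3 → ℝ) : Fin 3 → ℝ :=
  ![c * v 0 + s * (v 2 - 2 * v 1),
    c * v 1 + 2 * s * v 0 + (1 - c) / 5 * (v 1 + 2 * v 2),
    c * v 2 - s * v 0 + 2 * (1 - c) / 5 * (v 1 + 2 * v 2)]

/-- Component `0` of `rotE`. -/
@[simp] theorem rotE_apply_zero (c s : ℝ) (v : Fin 3 → ℝ) : rotE c s v 0 = c * v 0 + s * (v 2 - 2 * v 1) := rfl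

/-- Component `1` of `rotE`. -/
@[simp] theorem rotE_apply_one (c s : ℝ) (v : Fin 3 → ℝ) :
    rotE c s v 1 = c * v 1 + 2 * s * v 0 + (1 - c) / 5 * (v 1 + 2 * v 2) := rfl

/-- Component `2` of `rotE`. -/
@[simp] theorem rotE_apply_two (c s : ℝ) (v : Fin 3 → ℝ) :
    rotE c s v 2 = c * v 2 - s * v 0 + 2 * (1 - c) / 5 * (v 1 + 2 * v 2) := rfl

/-- `rotE 1 0` is the identity. -/
@[simp] theorem rotE_one_zero (v : Fin 3 → ℝ) : rotE 1 0 v = v := by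
  ext i; fin_cases i <;> simp

/-- `rotE` is additive. -/
theorem rotE_add (c s : ℝ) (v w : Fin 3 → ℝ) : rotE c s (v + w) = rotE c s v + rotE c s w := by
  ext i; fin_cases i <;> simp <;> ring

/-- `rotE` is homogeneous. -/
theorem rotE_smul (c s r : ℝ) (v : Fin 3 → ℝ) : rotE c s (r • v) = r • rotE c s v := by
  ext i; fin_cases i <;> simp <;> ring

/-- `rotE` commutes with subtraction. -/
theorem rotE_sub (c s : ℝ) (v w : Fin 3 → ℝ) : rotE c s (v - w) = rotE c s v - rotE c s w := by
  ext i; fin_cases i <;> simp <;> ring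

/-- `rotE` commutes with negation. -/
theorem rotE_neg (c s : ℝ) (v : Fin 3 → ℝ) : rotE c s (-v) = -rotE c s v := by
  ext i; fin_cases i <;> simp <;> ring

/-- `rotE` fixes the height along the axis EXACTLY: `rotE c s v · e = v · e`. -/
theorem rotE_dotProduct_e (c s : ℝ) (v : Fin 3 → ℝ) :
    rotE c s v ⬝ᵥ (![0, 1, 2] : Fin 3 → ℝ) = v ⬝ᵥ (![0, 1, 2] : Fin 3 → ℝ) := by
  simp [dotProduct, Fin.sum_univ_three]; ring

/-- On the ellipse `rotE` preserves dot products. -/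
theorem rotE_dotProduct {c s : ℝ} (h : c ^ 2 + 5 * s ^ 2 = 1) (v w : Fin 3 → ℝ) :
    rotE c s v ⬝ᵥ rotE c s w = v ⬝ᵥ w := by
  simp only [dotProduct, Fin.sum_univ_three, rotE_apply_zero, rotE_apply_one, rotE_apply_two]
  linear_combination (v 0 * w 0 + (4 / 5 : ℝ) * v 1 * w 1 - (2 / 5 : ℝ) * v 1 * w 2 - (2 / 5 : ℝ) * v 2 * w 1 +
    (1 / 5 : ℝ) * v 2 * w 2) * h

/-- On the ellipse `rotE` preserves cross products. -/
theorem rotE_cross {c s : ℝ} (h : c ^ 2 + 5 * s ^ 2 = 1) (v w : Fin 3 → ℝ) :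
    rotE c s v ⨯₃ rotE c s w = rotE c s (v ⨯₃ w) := by
  ext i; fin_cases i <;> simp [cross_apply]
  · ring
  · linear_combination ((2 / 5 : ℝ) * v 0 * w 1 - (1 / 5 : ℝ) * v 0 * w 2 - (2 / 5 : ℝ) * v 1 * w 0 +
      (1 / 5 : ℝ) * v 2 * w 0) * h
  · linear_combination ((4 / 5 : ℝ) * v 0 * w 1 - (2 / 5 : ℝ) * v 0 * w 2 - (4 / 5 : ℝ) * v 1 * w 0 +
      (2 / 5 : ℝ) * v 2 * w 0) * h

/-- **Angle addition** (exact): `rotE c s ∘ rotE c₁ s₁ = rotE (c c₁ − 5 s s₁) (c s₁ + s c₁)`. -/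
theorem rotE_rotE (c s c₁ s₁ : ℝ) (v : Fin 3 → ℝ) :
    rotE c s (rotE c₁ s₁ v) = rotE (c * c₁ - 5 * s * s₁) (c * s₁ + s * c₁) v := by
  ext i; fin_cases i <;> simp <;> ring

/-- The parameters compose on the ellipse. -/
theorem ellipse_rotE_rotE {c s c₁ s₁ : ℝ} (h : c ^ 2 + 5 * s ^ 2 = 1) (h₁ : c₁ ^ 2 + 5 * s₁ ^ 2 = 1) :
    (c * c₁ - 5 * s * s₁) ^ 2 + 5 * (c * s₁ + s * c₁) ^ 2 = 1 := by
  linear_combination (c₁ ^ 2 + 5 * s₁ ^ 2) * h + h₁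

/-! ### Cone positivity -/

/-- **Cone positivity.**  If `Zc` lies in the open period cone about `e = (0,1,2)` (`0 < Zc·e`, `9 Zc·Zc < 2 (Zc·e)²`,
angular radius `arcsin (1/√10)`) and `v` makes an angle at most `arccos (1/√10)` with the axis (`0 < v·e`, `v·v ≤ 2 (v·e)²`),
then `0 < Zc·v`.  (Decompose along `e`; Cauchy–Schwarz in `e^⊥`.) -/
theorem cone_pos {Zc v : Fin 3 → ℝ} (hZe : 0 < Zc ⬝ᵥ (![0, 1, 2] : Fin 3 → ℝ))
    (hZ : 9 * (Zc ⬝ᵥ Zc) < 2 * (Zc ⬝ᵥ (![0, 1, 2] : Fin 3 → ℝ)) ^ 2)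
    (hve : 0 < v ⬝ᵥ (![0, 1, 2] : Fin 3 → ℝ)) (hv : v ⬝ᵥ v ≤ 2 * (v ⬝ᵥ (![0, 1, 2] : Fin 3 → ℝ)) ^ 2) :
    0 < Zc ⬝ᵥ v := by
  simp only [dotProduct, Fin.sum_univ_three, Matrix.cons_val_zero, Matrix.cons_val_one, Matrix.cons_val_two,
    Matrix.head_cons, Matrix.tail_cons, mul_zero, mul_one, zero_add] at *
  -- `a = Zc·e`, `b = v·e`; transverse parts `(Zc 0, 2τ/5, −τ/5)`, `(v 0, 2ω/5, −ω/5)`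
  set a : ℝ := Zc 1 + Zc 2 * 2 with ha
  set b : ℝ := v 1 + v 2 * 2 with hb
  set τ : ℝ := 2 * Zc 1 - Zc 2 with hτ
  set ω : ℝ := 2 * v 1 - v 2 with hω
  have hZ1 : Zc 1 = (a + 2 * τ) / 5 := by rw [ha, hτ]; ring
  have hZ2 : Zc 2 = (2 * a - τ) / 5 := by rw [ha, hτ]; ring
  have hv1 : v 1 = (b + 2 * ω) / 5 := by rw [hb, hω]; ring
  have hv2 : v 2 = (2 * b - ω) / 5 := by rw [hb, hω]; ring
  -- transverse norms
  have hZt : Zc 0 ^ 2 + τ ^ 2 / 5 < a ^ 2 / 45 := by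
    have e1 : Zc 0 * Zc 0 + Zc 1 * Zc 1 + Zc 2 * Zc 2 = a ^ 2 / 5 + (Zc 0 ^ 2 + τ ^ 2 / 5) := by
      rw [hZ1, hZ2]; ring
    rw [e1] at hZ; nlinarith [hZ]
  have hvt : v 0 ^ 2 + ω ^ 2 / 5 ≤ 9 * b ^ 2 / 5 := by
    have e1 : v 0 * v 0 + v 1 * v 1 + v 2 * v 2 = b ^ 2 / 5 + (v 0 ^ 2 + ω ^ 2 / 5) := by
      rw [hv1, hv2]; ring
    rw [e1] at hv; nlinarith [hv]
  -- the goal in these coordinates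
  have eg : Zc 0 * v 0 + Zc 1 * v 1 + Zc 2 * v 2 = a * b / 5 + (Zc 0 * v 0 + τ * ω / 5) := by
    rw [hZ1, hZ2, hv1, hv2]; ring
  rw [eg]
  set p : ℝ := Zc 0 * v 0 + τ * ω / 5 with hp
  have hCS : p ^ 2 ≤ (Zc 0 ^ 2 + τ ^ 2 / 5) * (v 0 ^ 2 + ω ^ 2 / 5) := by
    rw [hp]; nlinarith [sq_nonneg (Zc 0 * ω - τ * v 0)]
  have hab : 0 < a * b / 5 := by positivity
  have hp2 : p ^ 2 < (a * b / 5) ^ 2 := by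
    have h1 : (Zc 0 ^ 2 + τ ^ 2 / 5) * (v 0 ^ 2 + ω ^ 2 / 5) ≤ (Zc 0 ^ 2 + τ ^ 2 / 5) * (9 * b ^ 2 / 5) :=
      mul_le_mul_of_nonneg_left hvt (by positivity)
    have h2 : (Zc 0 ^ 2 + τ ^ 2 / 5) * (9 * b ^ 2 / 5) < (a ^ 2 / 45) * (9 * b ^ 2 / 5) :=
      mul_lt_mul_of_pos_right hZt (by positivity)
    have e2 : (a ^ 2 / 45) * (9 * b ^ 2 / 5) = (a * b / 5) ^ 2 := by ring
    linarith [hCS, h1, h2, e2.le, e2.ge]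
  nlinarith [hp2, hab, sq_nonneg (p + a * b / 5)]


/-! ### One push on the disc -/

/-- Numeric facts: heights and squared lengths of the two margin vectors `(0,1,1) − (1,1,0)` and `(1,0,1) − (1,1,0)`. -/
theorem terraceDisc_base_facts :
    ((![0, 1, 1] : Fin 3 → ℝ) - ![1, 1, 0]) ⬝ᵥ (![0, 1, 2] : Fin 3 → ℝ) = 2 ∧
    ((![0, 1, 1] : Fin 3 → ℝ) - ![1, 1, 0]) ⬝ᵥ ((![0, 1, 1] : Fin 3 → ℝ) - ![1, 1, 0]) = 2 ∧
    ((![1, 0, 1] : Fin 3 → ℝ) - ![1, 1, 0]) ⬝ᵥ (![0, 1, 2] : Fin 3 → ℝ) = 1 ∧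
    ((![1, 0, 1] : Fin 3 → ℝ) - ![1, 1, 0]) ⬝ᵥ ((![1, 0, 1] : Fin 3 → ℝ) - ![1, 1, 0]) = 2 := by
  refine ⟨?_, ?_, ?_, ?_⟩ <;> norm_num [dotProduct, Fin.sum_univ_three, Matrix.cons_val_zero, Matrix.cons_val_one,
    Matrix.cons_val_two, Matrix.head_cons, Matrix.tail_cons]

/-- **Cone selection.**  For `Zc` in the open period cone, `rotE c s (1,1,0)` is strictly `Zc`-below `rotE c s (0,1,1)`
and `rotE c s (1,0,1)` (on the ellipse): the two margin vectors have `(v·e, v·v) = (2, 2)` and `(1, 2)`. -/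
theorem terraceDisc_select {c s : ℝ} (h : c ^ 2 + 5 * s ^ 2 = 1) {Zc : Fin 3 → ℝ}
    (hZe : 0 < Zc ⬝ᵥ (![0, 1, 2] : Fin 3 → ℝ)) (hZ : 9 * (Zc ⬝ᵥ Zc) < 2 * (Zc ⬝ᵥ (![0, 1, 2] : Fin 3 → ℝ)) ^ 2) :
    Zc ⬝ᵥ rotE c s ![1, 1, 0] < Zc ⬝ᵥ rotE c s ![0, 1, 1] ∧
      Zc ⬝ᵥ rotE c s ![1, 1, 0] < Zc ⬝ᵥ rotE c s ![1, 0, 1] := by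
  obtain ⟨f1, f2, f3, f4⟩ := terraceDisc_base_facts
  constructor
  · have hv := cone_pos (v := rotE c s (![0, 1, 1] - ![1, 1, 0])) hZe hZ
      (by rw [rotE_dotProduct_e, f1]; norm_num) (by rw [rotE_dotProduct h, rotE_dotProduct_e, f1, f2]; norm_num)
    rw [rotE_sub, dotProduct_sub] at hv
    linarith
  · have hv := cone_pos (v := rotE c s (![1, 0, 1] - ![1, 1, 0])) hZe hZ
      (by rw [rotE_dotProduct_e, f3]; norm_num) (by rw [rotE_dotProduct h, rotE_dotProduct_e, f3, f4]; norm_num)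
    rw [rotE_sub, dotProduct_sub] at hv
    linarith

/-- **One push on the disc is the rotation `ρ`.**  With `X = rotE c s (0,1,1)`, `P = rotE c s (1,1,1)` on the ellipse and
`Zc` in the open period cone: the selection hypotheses of `ray_push_cubic` hold for the third member `Xj = rotE c s (1,1,0)`,
and the updated numerators are `rotE c' s' (0,1,1)`, `rotE c' s' (1,1,1)` with `(c', s') = (−2c/3 + 5s/3, −c/3 − 2s/3)`. -/
theorem terraceDisc_push {c s : ℝ} (h : c ^ 2 + 5 * s ^ 2 = 1) {Zc : Fin 3 → ℝ}
    (hZe : 0 < Zc ⬝ᵥ (![0, 1, 2] : Fin 3 → ℝ)) (hZ : 9 * (Zc ⬝ᵥ Zc) < 2 * (Zc ⬝ᵥ (![0, 1, 2] : Fin 3 → ℝ)) ^ 2) :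
    (rotE c s ![1, 1, 0] = rotE c s ![0, 1, 1] ∨
      rotE c s ![1, 1, 0] = (1 / 2 : ℝ) • (-rotE c s ![0, 1, 1] + rotE c s ![1, 1, 1] ⨯₃ rotE c s ![0, 1, 1] +
        (2 : ℝ) • rotE c s ![1, 1, 1]) ∨
      rotE c s ![1, 1, 0] = (1 / 2 : ℝ) • (-rotE c s ![0, 1, 1] - rotE c s ![1, 1, 1] ⨯₃ rotE c s ![0, 1, 1] +
        (2 : ℝ) • rotE c s ![1, 1, 1])) ∧
    (∀ Y : Fin 3 → ℝ, (Y = rotE c s ![0, 1, 1] ∨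
        Y = (1 / 2 : ℝ) • (-rotE c s ![0, 1, 1] + rotE c s ![1, 1, 1] ⨯₃ rotE c s ![0, 1, 1] +
          (2 : ℝ) • rotE c s ![1, 1, 1]) ∨
        Y = (1 / 2 : ℝ) • (-rotE c s ![0, 1, 1] - rotE c s ![1, 1, 1] ⨯₃ rotE c s ![0, 1, 1] +
          (2 : ℝ) • rotE c s ![1, 1, 1])) →
      Y ≠ rotE c s ![1, 1, 0] → Zc ⬝ᵥ rotE c s ![1, 1, 0] < Zc ⬝ᵥ Y) ∧
    (4 / 3 : ℝ) • rotE c s ![1, 1, 1] - rotE c s ![1, 1, 0] =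
      rotE (-2 / 3 * c + 5 / 3 * s) (-1 / 3 * c - 2 / 3 * s) ![0, 1, 1] ∧
    (5 / 3 : ℝ) • rotE c s ![1, 1, 1] - (2 : ℝ) • rotE c s ![1, 1, 0] =
      rotE (-2 / 3 * c + 5 / 3 * s) (-1 / 3 * c - 2 / 3 * s) ![1, 1, 1] := by
  obtain ⟨hs₁, hs₂⟩ := terraceDisc_select h hZe hZ
  have h₂ : (1 / 2 : ℝ) • (-rotE c s ![0, 1, 1] + rotE c s ![1, 1, 1] ⨯₃ rotE c s ![0, 1, 1] +
      (2 : ℝ) • rotE c s ![1, 1, 1]) = rotE c s ![1, 0, 1] := by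
    ext i; fin_cases i <;> simp [cross_apply, Matrix.vecHead, Matrix.vecTail]
    · ring
    · linear_combination (1 / 10 : ℝ) * h
    · linear_combination (1 / 5 : ℝ) * h
  have h₃ : (1 / 2 : ℝ) • (-rotE c s ![0, 1, 1] - rotE c s ![1, 1, 1] ⨯₃ rotE c s ![0, 1, 1] +
      (2 : ℝ) • rotE c s ![1, 1, 1]) = rotE c s ![1, 1, 0] := by
    ext i; fin_cases i <;> simp [cross_apply, Matrix.vecHead, Matrix.vecTail]
    · ring
    · linear_combination (-1 / 10 : ℝ) * h
    · linear_combination (-1 / 5 : ℝ) * h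
  obtain ⟨hj, hlt⟩ := triple_selection (Zc := Zc) h₂ h₃ (Or.inr (Or.inr rfl)) (fun _ => hs₁) (fun _ => hs₂)
    (fun hne => (hne rfl).elim)
  refine ⟨hj, hlt, ?_, ?_⟩
  · ext i; fin_cases i <;> simp <;> ring
  · ext i; fin_cases i <;> simp <;> ring

/-! ### All levels -/

/-- The parameters of `ρᵏ`, `ρ = rotE (−2/3) (−1/3)`: `(1, 0)` and then `(c, s) ↦ (−2c/3 + 5s/3, −c/3 − 2s/3)`. -/
def discCS : ℕ → ℝ × ℝ
  | 0 => (1, 0)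
  | k + 1 => (-2 / 3 * (discCS k).1 + 5 / 3 * (discCS k).2, -1 / 3 * (discCS k).1 - 2 / 3 * (discCS k).2)

/-- `discCS 0 = (1, 0)`. -/
@[simp] theorem discCS_zero : discCS 0 = (1, 0) := rfl

/-- Unfolding `discCS (k + 1)`. -/
theorem discCS_succ (k : ℕ) :
    discCS (k + 1) = (-2 / 3 * (discCS k).1 + 5 / 3 * (discCS k).2, -1 / 3 * (discCS k).1 - 2 / 3 * (discCS k).2) := rfl

/-- The parameters stay on the ellipse `c² + 5s² = 1`. -/
theorem discCS_ellipse : ∀ k : ℕ, (discCS k).1 ^ 2 + 5 * (discCS k).2 ^ 2 = 1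
  | 0 => by norm_num [discCS]
  | k + 1 => by
    rw [discCS_succ]
    linear_combination discCS_ellipse k

/-- `rotE (discCS (k+1)) = rotE (discCS k) ∘ ρ`: the parameters are those of the powers of `ρ = rotE (−2/3) (−1/3)`. -/
theorem rotE_discCS_succ (k : ℕ) (v : Fin 3 → ℝ) :
    rotE (discCS (k + 1)).1 (discCS (k + 1)).2 v = rotE (discCS k).1 (discCS k).2 (rotE (-2 / 3) (-1 / 3) v) := by
  rw [rotE_rotE, discCS_succ]
  congr 1 <;> ring

/-- **The terrace ray on the disc, all levels.**  Base frame `A`, first push normal `n` = the terrace (`κ(n) = (1,1,1)/√3`,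
positive on `u = slotSite 8`), steering `z` whose cubic direction `Zc` lies in the open period cone about `(0,1,2)`.  Then
level `k` of the forced ray `forcedTop z ⟨A, slotSite 8, 0⟩ n k` has direction numerator `rotE (discCS (k+1)) (0,1,1)` and
next push normal numerator `rotE (discCS (k+1)) (1,1,1)` — independently of `Zc`. -/
theorem terraceDisc_levels (A : EuclideanSpace ℝ (Fin 3) ≃ₗᵢ[ℝ] EuclideanSpace ℝ (Fin 3))
    {n z : EuclideanSpace ℝ (Fin 3)} {Zc : Fin 3 → ℝ} {t : ℝ} (hn : ‖n‖ = 1)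
    (hmenu : ∀ w ∈ fccSlots, ⟪A w, n⟫_ℝ = 0 ∨ ⟪A w, n⟫_ℝ = Real.sqrt (2 / 3) ∨ ⟪A w, n⟫_ℝ = -Real.sqrt (2 / 3))
    (hpos : ⟪A (slotSite 8), n⟫_ℝ = Real.sqrt (2 / 3))
    (hPn : cubicCoords (A.symm n) = (Real.sqrt 3)⁻¹ • (![(1 : ℝ), 1, 1] : Fin 3 → ℝ))
    (hZ : cubicCoords (A.symm z) = t • Zc) (ht : 0 < t)
    (hZe : 0 < Zc ⬝ᵥ (![0, 1, 2] : Fin 3 → ℝ)) (hZc : 9 * (Zc ⬝ᵥ Zc) < 2 * (Zc ⬝ᵥ (![0, 1, 2] : Fin 3 → ℝ)) ^ 2) :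
    ∀ k : ℕ,
      cubicCoords (A.symm ((forcedTop z ⟨A, slotSite 8, 0⟩ n k).frame (forcedTop z ⟨A, slotSite 8, 0⟩ n k).dir)) =
          (Real.sqrt 2)⁻¹ • rotE (discCS (k + 1)).1 (discCS (k + 1)).2 ![0, 1, 1] ∧
        cubicCoords (A.symm (nextNormal (forcedTop z ⟨A, slotSite 8, 0⟩ n k))) =
          (Real.sqrt 3)⁻¹ • rotE (discCS (k + 1)).1 (discCS (k + 1)).2 ![1, 1, 1]
  | 0 => by
    obtain ⟨hj, hlt, u1, u2⟩ := terraceDisc_push (discCS_ellipse 0) hZe hZc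
    have hX : cubicCoords (slotSite 8) = (Real.sqrt 2)⁻¹ • rotE (discCS 0).1 (discCS 0).2 ![0, 1, 1] := by
      rw [cubicCoords_slotSite_eight, discCS_zero, rotE_one_zero]
    have hP : cubicCoords (A.symm n) = (Real.sqrt 3)⁻¹ • rotE (discCS 0).1 (discCS 0).2 ![1, 1, 1] := by
      rw [hPn, discCS_zero, rotE_one_zero]
    obtain ⟨h1, h2⟩ := forcedTop_zero_cubic A (slotSite_mem 8) hn hmenu hpos hZ ht hX hP hj hlt
    rw [u1] at h1; rw [u2] at h2
    exact ⟨h1, h2⟩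
  | k + 1 => by
    obtain ⟨hX, hP⟩ := terraceDisc_levels A hn hmenu hpos hPn hZ ht hZe hZc k
    obtain ⟨hj, hlt, u1, u2⟩ := terraceDisc_push (discCS_ellipse (k + 1)) hZe hZc
    obtain ⟨h1, h2⟩ := forcedTop_succ_cubic A hn hmenu hZ ht k hX hP hj hlt
    rw [u1] at h1; rw [u2] at h2
    exact ⟨h1, h2⟩

/-- **Every direction of the disc ray has `X·e = 3`** (rise cosine `3/√10` against the axis `(0,1,2)/√5`), and every
next push normal has `P·e = 3`. -/
theorem terraceDisc_dotProduct_e (k : ℕ) :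
    rotE (discCS k).1 (discCS k).2 ![0, 1, 1] ⬝ᵥ (![0, 1, 2] : Fin 3 → ℝ) = 3 ∧
      rotE (discCS k).1 (discCS k).2 ![1, 1, 1] ⬝ᵥ (![0, 1, 2] : Fin 3 → ℝ) = 3 := by
  rw [rotE_dotProduct_e, rotE_dotProduct_e]
  constructor <;> norm_num [dotProduct, Fin.sum_univ_three, Matrix.cons_val_zero, Matrix.cons_val_one,
    Matrix.cons_val_two, Matrix.head_cons, Matrix.tail_cons]

/-- **Every direction of the disc ray rises in every cone steering**: `0 < Zc · X_k` (from `cone_pos` with `X·e = 3`,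
`X·X = 2`). -/
theorem terraceDisc_dir_pos {Zc : Fin 3 → ℝ} (hZe : 0 < Zc ⬝ᵥ (![0, 1, 2] : Fin 3 → ℝ))
    (hZc : 9 * (Zc ⬝ᵥ Zc) < 2 * (Zc ⬝ᵥ (![0, 1, 2] : Fin 3 → ℝ)) ^ 2) (k : ℕ) :
    0 < Zc ⬝ᵥ rotE (discCS k).1 (discCS k).2 ![0, 1, 1] := by
  have he := (terraceDisc_dotProduct_e k).1
  refine cone_pos hZe hZc (by rw [he]; norm_num) ?_
  rw [rotE_dotProduct (discCS_ellipse k), he]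
  norm_num [dotProduct, Fin.sum_univ_three, Matrix.cons_val_zero, Matrix.cons_val_one, Matrix.cons_val_two,
    Matrix.head_cons, Matrix.tail_cons]

end Summit.Ventures.Crystal3D.Theorems

end
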